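import Literature.MathematicalPhysics.QuantumFieldTheory.Balaban1983to89.B1Eq324BenfattoSect5Boxes
import HarnessLib

/-!
# `Balaban1983to89.B1Eq324BenfattoSect5Pavements` — [BenfattoEtAl1978] §5 p. 154 / p. 159: THE TERMINATION OF THE ITERATION —
# with `d + 1` suitably displaced pavements «(J∩Γ₁)∩Γ₂∩…∩Γ_{d+1} = ∅», as a lattice-geometry theorem (pigeonhole on the coordinates)

statement-level skeleton of published theorems with citation tags; proofs where landed; nothing here is a claim about the
Yang–Mills mass gap

WHY THIS MODULE (cell `pub-ymgap`, seat `dag-n08-d` gen 8, INTENT-22; node N08 [Balaban1985UV3]; the [BenfattoEtAl1978] source chain behind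
the (α)-row `h324c`).  The proof of the Basic Lemma (p. 152) iterates the corridor construction of `B1Eq324BenfattoSect5Boxes`: p. 153–154
*"Hence we can apply the same argument … by choosing the □'s out of a pavement with boxes of the same size of the former ones but shifted
in location. In this way the initial problem is reduced to the case in which J is replaced by (J∩Γ₁)∩Γ₂ where Γ₂ are the new corridors.
After (d+1) steps one can obviously manage by suitably choosing the successive displaced pavements so that (J∩Γ₁)∩Γ₂∩…∩Γ_{d+1} = ∅
thereby reducing the proof of the lemma to the trivial case H_J = 0"*, and p. 159 *"we can proceed as before choosing a new pavement Q′_b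
displaced by b²/2 with respect to Q_b … a third pavement Q″_b displaced by b²/4 with respect to Q′_b and, if d = 3, a fourth one
displaced by b²/16 w.r.t. Q″_b"*.  This file types the «obviously»: the geometric fact that `d + 1` corridor networks of pavements whose
shifts are pairwise `≥ 2w` away from `Lℤ` in every coordinate have EMPTY common intersection.

DICTIONARY.  The outer-corridor network `Γ₁` of the pavement of side `L` SHIFTED by `s ∈ ℤ^d` ↦ the predicate `InCorridor L w s x`:
some coordinate of `x − s` lies within `w` of `Lℤ` (`(x_i − s_i) mod L < w` or `≥ L − w`); at shift `0` this is membership in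
`Sect5Boxes.frame1 L w (boxIndex L x)` (`inCorridor_zero_iff`).  Print's shifts `0, b²/2, b²/4, b²/16` (the same in every coordinate) are
pairwise at distance `≥ b²/16 − … ≥ 2b^{3/2} = 2w` from `b²ℤ` for `b` large; the typed theorem keeps the shifts abstract under exactly that
separation hypothesis.

WHAT IS HERE (standard axioms; no `sorry`): def `InCorridor`; private `exists_rep_of_near` (a coordinate within `w` of `Lℤ` is `qL + e` with
`−w ≤ e < w`); `inCorridor_zero_iff`; ★★ `not_forall_inCorridor` — for `s : Fin (d+1) → ℤ^d` with `2w ≤ |s_k,i − s_k′,i − qL|` for all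
`k ≠ k′`, `i`, `q`, NO site lies in all `d + 1` corridor networks (two of the `d + 1` witnessing coordinates coincide by pigeonhole; the two
shifts then differ by less than `2w` modulo `L` in that coordinate); `filter_forall_inCorridor_eq_empty` (Finset form: `(J∩Γ₁)∩…∩Γ_{d+1} = ∅`).
HONEST SCOPE.  Geometry only; the analytic bookkeeping of the iteration ((5.34)–(5.35), the error accumulation) is not here.  count-neutral
for N08; `BasicLemmaPrinted` NOT discharged; nothing about d = 4, the continuum, OS axioms, a mass gap or the Clay problem.
-/

noncomputable section

open Finset
open scoped BigOperators

namespace Literature.MathematicalPhysics.QuantumFieldTheory.Balaban1983to89.B1Eq324BenfattoSect5Pavements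

open Literature.MathematicalPhysics.QuantumFieldTheory.Balaban1983to89.B1Eq324BenfattoLemma
open Literature.MathematicalPhysics.QuantumFieldTheory.Balaban1983to89.B1Eq324BenfattoSect5Boxes

variable {d : ℕ}

/-- **The outer-corridor network of a displaced pavement**: `x` lies in `Γ₁` of the pavement of side `L` shifted by `s` iff some
coordinate of `x − s` is within `w` of `Lℤ` — «a pavement with boxes of the same size of the former ones but shifted in location».
[cite: BenfattoEtAl1978, §5 p.153–154; p.159] -/
def InCorridor (L w : ℕ) (s x : B1Eq324BenfattoLemma.Site d) : Prop :=
  ∃ i, (x i - s i) % (L : ℤ) < w ∨ (L : ℤ) - w ≤ (x i - s i) % (L : ℤ)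

/-- kernel: an integer within `w` of `Lℤ` (residue `< w` or `≥ L − w`) is `qL + e` with `−w ≤ e < w`. [folklore] -/
private theorem exists_rep_of_near {L w : ℕ} (hL : 0 < L) {t : ℤ} (h : t % (L : ℤ) < w ∨ (L : ℤ) - w ≤ t % (L : ℤ)) :
    ∃ q e : ℤ, t = q * L + e ∧ -(w : ℤ) ≤ e ∧ e < w := by
  have hL' : (0 : ℤ) < L := by exact_mod_cast hL
  have hr0 : 0 ≤ t % (L : ℤ) := Int.emod_nonneg _ hL'.ne'
  have hrL : t % (L : ℤ) < L := Int.emod_lt_of_pos _ hL'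
  have hdiv : (L : ℤ) * (t / L) + t % L = t := Int.mul_ediv_add_emod t L
  have hw : (0 : ℤ) ≤ w := by exact_mod_cast Nat.zero_le w
  rcases h with h | h
  · exact ⟨t / L, t % L, by linarith, by linarith, h⟩
  · exact ⟨t / L + 1, t % L - L, by linarith, by linarith, by linarith⟩

/-- **Consistency with `Sect5Boxes`**: at shift `0`, `InCorridor L w 0 x` is membership of `x` in the outer corridor `Γ₁(□)` of its own
tessera (`L ≥ 1`). [cite: BenfattoEtAl1978, (5.7) p.154] -/
theorem inCorridor_zero_iff {L w : ℕ} (hL : 0 < L) (x : B1Eq324BenfattoLemma.Site d) :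
    InCorridor L w 0 x ↔ x ∈ frame1 L w (boxIndex L x) := by
  have hL' : (0 : ℤ) < L := by exact_mod_cast hL
  rw [frame1, Finset.mem_sdiff, mem_shrink_iff]
  simp only [InCorridor, Pi.zero_apply, sub_zero, mem_box_boxIndex hL x, true_and, not_forall, not_and, not_lt]
  refine exists_congr fun i => ?_
  have hdiv : (L : ℤ) * (x i / L) + x i % L = x i := Int.mul_ediv_add_emod (x i) L
  have hb : boxIndex L x i = x i / L := rfl
  rw [hb]
  constructor
  · rintro (h | h)
    · intro h1
      linarith
    · intro _
      linarith
  · intro h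
    by_cases h1 : x i / ↑L * ↑L + ↑w ≤ x i
    · right
      have := h h1
      linarith
    · left
      push Not at h1
      linarith

/-- **«(J∩Γ₁)∩Γ₂∩…∩Γ_{d+1} = ∅» — THE ITERATION TERMINATES**: for `d + 1` pavements of side `L` whose shifts `s_k` are pairwise at distance
`≥ 2w` from `Lℤ` in EVERY coordinate (`2w ≤ |s_k,i − s_k′,i − qL|`), no site of `ℤ^d` lies in all `d + 1` outer-corridor networks: if it did,
each pavement `k` would have a witnessing coordinate `i_k`; two of the `d + 1` witnesses coincide (pigeonhole), and in that coordinate both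
`x − s_k` and `x − s_k′` are within `w` of `Lℤ`, forcing `s_k − s_k′` within `< 2w` of `Lℤ` — contradiction.
[cite: BenfattoEtAl1978, §5 p.154 «(J∩Γ₁)∩Γ₂∩…∩Γ_{d+1} = ∅»; p.159] -/
theorem not_forall_inCorridor {L w : ℕ} (hL : 0 < L) (s : Fin (d + 1) → B1Eq324BenfattoLemma.Site d)
    (hsep : ∀ k k' : Fin (d + 1), k ≠ k' → ∀ (i : Fin d) (q : ℤ), (2 * w : ℤ) ≤ |s k i - s k' i - q * L|)
    (x : B1Eq324BenfattoLemma.Site d) : ¬ ∀ k, InCorridor L w (s k) x := by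
  intro h
  choose i hi using h
  obtain ⟨k, k', hne, heq⟩ := Fintype.exists_ne_map_eq_of_card_lt i (by simp)
  obtain ⟨q, e, ht, he1, he2⟩ := exists_rep_of_near hL (hi k)
  have hk' := hi k'
  rw [← heq] at hk'
  obtain ⟨q', e', ht', he1', he2'⟩ := exists_rep_of_near hL hk'
  have hs := hsep k k' hne (i k) (q' - q)
  have hdiff : s k (i k) - s k' (i k) - (q' - q) * (L : ℤ) = e' - e := by linarith
  rw [hdiff] at hs
  have habs : |e' - e| < 2 * w := abs_sub_lt_iff.mpr ⟨by linarith, by linarith⟩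
  linarith

/-- **Finset form**: for a finite region `J`, the sites of `J` in all `d + 1` corridor networks form the EMPTY set.
[cite: BenfattoEtAl1978, §5 p.154] -/
theorem filter_forall_inCorridor_eq_empty {L w : ℕ} (hL : 0 < L) (s : Fin (d + 1) → B1Eq324BenfattoLemma.Site d)
    (hsep : ∀ k k' : Fin (d + 1), k ≠ k' → ∀ (i : Fin d) (q : ℤ), (2 * w : ℤ) ≤ |s k i - s k' i - q * L|)
    (J : Finset (B1Eq324BenfattoLemma.Site d)) [DecidablePred fun x : B1Eq324BenfattoLemma.Site d => ∀ k, InCorridor L w (s k) x] :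
    J.filter (fun x => ∀ k, InCorridor L w (s k) x) = ∅ := by
  refine Finset.filter_eq_empty_iff.mpr fun x _ => ?_
  exact not_forall_inCorridor hL s hsep x

end Literature.MathematicalPhysics.QuantumFieldTheory.Balaban1983to89.B1Eq324BenfattoSect5Pavements

end
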